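import Literature.AlgebraicGeometry.HodgeTheory.CMHodgeGroupNoTwistBalanced
import Literature.AlgebraicGeometry.HodgeTheory.CMHodgeGroupIrreducibleBlocks
import HarnessLib

/-!
# `Lie Hg ⊗ ℂ ⊇ 𝔲_E(V,ψ) ⊗ ℂ` for a CM field of degree `≤ 6` acting with multiplicity `2` and exactly one BALANCED place
# (the sextic CM pattern `(n_σ) = (2,2,1)`), under «no Weil-type quadratic element» — the Lie step of «`Hg = U_E`»
# (Moonen–Zarhin 1999 §2 (2.3); Ribet 1983 Thm. 0)

Family `hodge`, layer `Literature/AlgebraicGeometry/HodgeTheory` (brick P5(β), Hodge-structure half, of the design note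
`HOME/jobs/A7-inventory-eng5g6/DESIGN-rows10-12-allmembers.md` of the cell `pub-hodgeav-hg6`, req-37 (A) Q2b, TABLE X row 12
ALL MEMBERS, pattern `(2,2,1)`; companion of `CMHodgeGroupOneScalarPlace`). UNCONDITIONAL; theorems only, no definition, no
named fact, no `sorry`. HONEST FRAMING of that cell: HC / HC_AV / HC_CM / H2 NOT proved — linear algebra of polarized
weight-one `ℚ`-Hodge structures.

ASSEMBLY: `CMThetaSocket.mem_spanC_of_lift_of_centre` (socket) ← LIFT (`CMNoTwist.lift_of_unique_balanced`, with the
irreducibility `CMIrred.eigenspace_irreducible`) + CENTRE (`CMThetaCentre.centre_of_pair`, which needs the hypothesis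
`hnoWeil`: every non-zero `ψ`-skew `y ∈ E` with `y² ∈ ℚ·1` has `Tr(y_ℂ Θ) ≠ 0` — for `k = ℚ(y)` imaginary quadratic this
says that `k` does not act on `V^{1,0}` with multiplicities `(g/2, g/2)`; the members violating it have `Hg ⊊ U_E`).
* **`CMThetaOneBalanced.mem_spanC_of_commute_of_skew`** — `|ι| ≤ 3`, places `k₀` (balanced) and `k₁ ≠ k₂` (both
  `Θ`-scalar), any bracket-closed admissible `𝔤 ∋ Θ_ℂ`, `hnoWeil`: every `φ_ℂ`-commuting `ψ_ℂ`-skew operator lies in `𝔤_ℂ`.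
* **`CMThetaOneBalanced.mem_hodgeLieC_of_commute_of_skew`** — the case `𝔤 = Lie Hg(H)`.

## References
* [MoonenZarhin1999LowDim] B. Moonen, Yu. Zarhin, Math. Ann. 315 (1999), §2 (2.3), (1.8).
* [Ribet1983] K. A. Ribet, Amer. J. Math. 105 (1983), Thm. 0, §3.
* [Deligne1982HodgeCycles] P. Deligne, LNM 900 (1982), I §3 Prop. 3.4, §4 (p. 30).
-/

noncomputable section

open scoped TensorProduct
open Module

namespace Literature.AlgebraicGeometry.Motives

namespace HodgeStructure

universe u

variable {V : Type u} [AddCommGroup V] [Module ℚ V] {n : ℤ}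

/-- **`𝔤_ℂ ⊇ 𝔲_E(V,ψ)_ℂ` FOR A CM FIELD WITH ONE BALANCED PLACE, UNDER «NO WEIL-TYPE QUADRATIC ELEMENT»** (see the
module docstring).
[cite: MoonenZarhin1999LowDim, §2 (2.3)] [cite: Ribet1983, Thm. 0] [cite: Deligne1982HodgeCycles, I §3 Prop. 3.4] -/
theorem CMThetaOneBalanced.mem_spanC_of_commute_of_skew [Module.Finite ℚ V] [HodgeTensorFacts.{u, u}] {ι : Type}
    [Fintype ι] [DecidableEq ι] (hι : Fintype.card ι ≤ 3)
    (H : HodgeStructure V n) (hn : n = 1) (heff : H.IsEffective) (ψ : H.Polarization)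
    {φ : Module.End ℚ V} (hφE : φ ∈ H.endAlg) {m : ℕ} (hE : ∀ a ∈ H.endAlg, ∃ q : Fin m → ℚ, a = ∑ k, q k • φ ^ (k : ℕ))
    (hEdim : Module.finrank ℚ H.endAlg = 2 * Fintype.card ι)
    (hdiv : ∀ a ∈ H.endAlg, a ≠ 0 → ∃ b : Module.End ℚ V, b * a = 1)
    (μ : ι → ℂ) (hinj : Function.Injective μ) (hdist : ∀ k k', μ k' ≠ starRingEnd ℂ (μ k))
    (hrank : ∀ k, Module.finrank ℂ ↥(Module.End.eigenspace (φ.baseChange ℂ) (μ k) ⊓ H.piece 1 0) +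
      Module.finrank ℂ ↥(Module.End.eigenspace (φ.baseChange ℂ) (μ k) ⊓ H.piece 0 1) = 2)
    (htop : (⨆ kt : ι × Fin 2, Module.End.eigenspace (φ.baseChange ℂ)
      (if kt.2 = 0 then μ kt.1 else starRingEnd ℂ (μ kt.1))) = ⊤)
    (𝔤 : Submodule ℚ (Module.End ℚ V)) (hbr : ∀ X ∈ 𝔤, ∀ X' ∈ 𝔤, X * X' - X' * X ∈ 𝔤)
    (hcomm : ∀ X ∈ 𝔤, ∀ a : H.endAlg, X * (a : Module.End ℚ V) = (a : Module.End ℚ V) * X)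
    (hskew : ∀ X ∈ 𝔤, ∀ v w, ψ.form (X v) w + ψ.form v (X w) = 0)
    {Θ : Module.End ℂ (ℂ ⊗[ℚ] V)} (hΘ : ∀ p, ∀ x ∈ H.piece p (n - p), Θ x = ((2 * p - n : ℤ) : ℂ) • x)
    (hΘ𝔤 : Θ ∈ spanC 𝔤)
    (k₀ : ι) (hk₀ : Module.finrank ℂ ↥(Module.End.eigenspace (φ.baseChange ℂ) (μ k₀) ⊓ H.piece 1 0) ≠ 0 ∧
      Module.finrank ℂ ↥(Module.End.eigenspace (φ.baseChange ℂ) (μ k₀) ⊓ H.piece 0 1) ≠ 0)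
    (hunb : ∀ k, k ≠ k₀ → Module.finrank ℂ ↥(Module.End.eigenspace (φ.baseChange ℂ) (μ k) ⊓ H.piece 1 0) = 0 ∨
      Module.finrank ℂ ↥(Module.End.eigenspace (φ.baseChange ℂ) (μ k) ⊓ H.piece 0 1) = 0)
    (k₁ k₂ : ι) (hk₁₂ : k₁ ≠ k₂) (hk₁ : k₁ ≠ k₀) (hk₂ : k₂ ≠ k₀)
    (hnoWeil : ∀ y ∈ H.endAlg, y ≠ 0 → (∀ v w, ψ.form (y v) w + ψ.form v (y w) = 0) →
      (∃ q : ℚ, y * y = q • 1) → LinearMap.trace ℂ _ (y.baseChange ℂ * Θ) ≠ 0)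
    {Y : Module.End ℂ (ℂ ⊗[ℚ] V)} (hYφ : Y * φ.baseChange ℂ = φ.baseChange ℂ * Y)
    (hYskew : ∀ x y, ψ.form.baseChange ℂ (Y x) y + ψ.form.baseChange ℂ x (Y y) = 0) : Y ∈ spanC 𝔤 := by
  classical
  have hirr := fun k U hUW hU => CMIrred.eigenspace_irreducible H hn heff ψ hφE hE μ hinj hdist htop 𝔤 hΘ hΘ𝔤 hcomm
    hskew k U hUW hU
  have hlift := fun k Z hZ => CMNoTwist.lift_of_unique_balanced hι H hn heff ψ hφE hE hdiv μ hinj hdist hrank htop 𝔤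
    hbr hcomm hskew hΘ hΘ𝔤 hirr k₀ hk₀ hunb k Z hZ
  -- `φ† ≠ φ`: `φ†` acts on `W_{μ k₀} ≠ 0` by `conj (μ k₀) ≠ μ k₀`
  have hφadj : ψ.adjoint φ ≠ φ := by
    intro h
    have hfin : Module.finrank ℂ ↥(Module.End.eigenspace (φ.baseChange ℂ) (μ k₀)) = 2 := by
      rw [CMTheta.finrank_eigenspace_eq_add H hn heff hφE, hrank k₀]
    obtain ⟨w, hw, hw0⟩ := Submodule.exists_mem_ne_zero_of_ne_bot
      (fun h0 => by rw [h0, finrank_bot] at hfin; exact two_ne_zero hfin.symm :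
        Module.End.eigenspace (φ.baseChange ℂ) (μ k₀) ≠ ⊥)
    have h1 := CMNoTwist.adjoint_baseChange_apply H hn heff ψ hφE hE μ hinj hdist two_ne_zero hrank htop k₀ w hw
    rw [h, Module.End.mem_eigenspace_iff.1 hw] at h1
    exact hdist k₀ k₀ (smul_left_injective ℂ hw0 h1)
  -- every place is one of `k₀, k₁, k₂`
  have huniv : ∀ i, i = k₁ ∨ i = k₂ ∨ i = k₀ := by
    have h3 : ({k₁, k₂, k₀} : Finset ι) = Finset.univ := by
      apply Finset.eq_of_subset_of_card_le (Finset.subset_univ _)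
      rw [Finset.card_univ, Finset.card_insert_of_notMem (by simp [hk₁₂, hk₁]),
        Finset.card_insert_of_notMem (by simp [hk₂]), Finset.card_singleton]
      exact hι
    intro i
    have hi : i ∈ ({k₁, k₂, k₀} : Finset ι) := by rw [h3]; exact Finset.mem_univ _
    simpa using hi
  have hbal' : ∀ k, k ≠ k₁ → k ≠ k₂ → Module.finrank ℂ ↥(Module.End.eigenspace (φ.baseChange ℂ) (μ k) ⊓ H.piece 1 0) =
      Module.finrank ℂ ↥(Module.End.eigenspace (φ.baseChange ℂ) (μ k) ⊓ H.piece 0 1) := fun k h1 h2 => by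
    rcases huniv k with rfl | rfl | rfl
    · exact (h1 rfl).elim
    · exact (h2 rfl).elim
    · have h := hrank k; omega
  have ht : ((Module.finrank ℂ ↥(Module.End.eigenspace (φ.baseChange ℂ) (μ k₁) ⊓ H.piece 1 0) : ℤ) -
        Module.finrank ℂ ↥(Module.End.eigenspace (φ.baseChange ℂ) (μ k₁) ⊓ H.piece 0 1)) ^ 2 =
      ((Module.finrank ℂ ↥(Module.End.eigenspace (φ.baseChange ℂ) (μ k₂) ⊓ H.piece 1 0) : ℤ) -
        Module.finrank ℂ ↥(Module.End.eigenspace (φ.baseChange ℂ) (μ k₂) ⊓ H.piece 0 1)) ^ 2 := by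
    have h1 := hrank k₁; have h2 := hrank k₂; have u1 := hunb k₁ hk₁; have u2 := hunb k₂ hk₂
    rcases u1 with u1 | u1 <;> rcases u2 with u2 | u2 <;> simp only [u1, u2] at h1 h2 ⊢ <;> push_cast <;> nlinarith
  have ht0 : Module.finrank ℂ ↥(Module.End.eigenspace (φ.baseChange ℂ) (μ k₂) ⊓ H.piece 1 0) ≠
      Module.finrank ℂ ↥(Module.End.eigenspace (φ.baseChange ℂ) (μ k₂) ⊓ H.piece 0 1) := by
    have h := hrank k₂; have u := hunb k₂ hk₂; omega
  have hcentre := CMThetaCentre.centre_of_pair hι H hn heff ψ hφE hE hEdim hdiv hφadj μ hinj hdist two_ne_zero hrank htop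
    𝔤 hcomm hskew hΘ hΘ𝔤 hlift k₁ k₂ hk₁₂ hbal' ht ht0 hnoWeil
  exact CMThetaSocket.mem_spanC_of_lift_of_centre H hn heff ψ hφE hE μ hinj hdist htop 𝔤 hcomm hskew hlift hcentre
    hYφ hYskew

/-- **`Lie Hg(H)_ℂ ⊇ 𝔲_E(V,ψ)_ℂ` FOR A CM FIELD WITH ONE BALANCED PLACE, UNDER «NO WEIL-TYPE QUADRATIC ELEMENT»** (with
`Θ` the Hodge operator of `H`): every `φ_ℂ`-commuting `ψ_ℂ`-skew operator of `V_ℂ` lies in `Lie Hg(H) ⊗ ℂ` — the hypothesis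
`hU` of the cell's census rows for these members. [cite: MoonenZarhin1999LowDim, §2 (2.3)]
[cite: Ribet1983, Thm. 0] [cite: Deligne1982HodgeCycles, I §3 Prop. 3.4] -/
theorem CMThetaOneBalanced.mem_hodgeLieC_of_commute_of_skew [Module.Finite ℚ V] [HodgeTensorFacts.{u, u}] {ι : Type}
    [Fintype ι] [DecidableEq ι] (hι : Fintype.card ι ≤ 3)
    (H : HodgeStructure V n) (hn : n = 1) (heff : H.IsEffective) (ψ : H.Polarization)
    {φ : Module.End ℚ V} (hφE : φ ∈ H.endAlg) {m : ℕ} (hE : ∀ a ∈ H.endAlg, ∃ q : Fin m → ℚ, a = ∑ k, q k • φ ^ (k : ℕ))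
    (hEdim : Module.finrank ℚ H.endAlg = 2 * Fintype.card ι)
    (hdiv : ∀ a ∈ H.endAlg, a ≠ 0 → ∃ b : Module.End ℚ V, b * a = 1)
    (μ : ι → ℂ) (hinj : Function.Injective μ) (hdist : ∀ k k', μ k' ≠ starRingEnd ℂ (μ k))
    (hrank : ∀ k, Module.finrank ℂ ↥(Module.End.eigenspace (φ.baseChange ℂ) (μ k) ⊓ H.piece 1 0) +
      Module.finrank ℂ ↥(Module.End.eigenspace (φ.baseChange ℂ) (μ k) ⊓ H.piece 0 1) = 2)
    (htop : (⨆ kt : ι × Fin 2, Module.End.eigenspace (φ.baseChange ℂ)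
      (if kt.2 = 0 then μ kt.1 else starRingEnd ℂ (μ kt.1))) = ⊤)
    (k₀ : ι) (hk₀ : Module.finrank ℂ ↥(Module.End.eigenspace (φ.baseChange ℂ) (μ k₀) ⊓ H.piece 1 0) ≠ 0 ∧
      Module.finrank ℂ ↥(Module.End.eigenspace (φ.baseChange ℂ) (μ k₀) ⊓ H.piece 0 1) ≠ 0)
    (hunb : ∀ k, k ≠ k₀ → Module.finrank ℂ ↥(Module.End.eigenspace (φ.baseChange ℂ) (μ k) ⊓ H.piece 1 0) = 0 ∨
      Module.finrank ℂ ↥(Module.End.eigenspace (φ.baseChange ℂ) (μ k) ⊓ H.piece 0 1) = 0)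
    (k₁ k₂ : ι) (hk₁₂ : k₁ ≠ k₂) (hk₁ : k₁ ≠ k₀) (hk₂ : k₂ ≠ k₀)
    (hnoWeil : ∀ Θ : Module.End ℂ (ℂ ⊗[ℚ] V), (∀ p, ∀ x ∈ H.piece p (n - p), Θ x = ((2 * p - n : ℤ) : ℂ) • x) →
      ∀ y ∈ H.endAlg, y ≠ 0 → (∀ v w, ψ.form (y v) w + ψ.form v (y w) = 0) →
      (∃ q : ℚ, y * y = q • 1) → LinearMap.trace ℂ _ (y.baseChange ℂ * Θ) ≠ 0)
    {Y : Module.End ℂ (ℂ ⊗[ℚ] V)} (hYφ : Y * φ.baseChange ℂ = φ.baseChange ℂ * Y)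
    (hYskew : ∀ x y, ψ.form.baseChange ℂ (Y x) y + ψ.form.baseChange ℂ x (Y y) = 0) : Y ∈ H.hodgeLieC := by
  obtain ⟨Θ, hΘ⟩ := exists_hodgeTheta H
  have hΘ𝔤 : Θ ∈ spanC H.hodgeLie := (hodgeLieC_eq_spanC H) ▸ H.mem_hodgeLieC_of_forall_piece hΘ
  rw [hodgeLieC_eq_spanC]
  exact CMThetaOneBalanced.mem_spanC_of_commute_of_skew hι H hn heff ψ hφE hE hEdim hdiv μ hinj hdist hrank htop H.hodgeLie
    (fun X hX X' hX' => H.commutator_mem_hodgeLie hX hX') (fun X hX a => H.commute_of_mem_hodgeLie hX a)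
    (fun X hX => form_apply_add_eq_zero_of_mem_hodgeLie ψ hX) hΘ hΘ𝔤 k₀ hk₀ hunb k₁ k₂ hk₁₂ hk₁ hk₂ (hnoWeil Θ hΘ) hYφ
    hYskew

end HodgeStructure

end Literature.AlgebraicGeometry.Motives
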